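import Mathlib
import Summits.ResolutionOfSingularities.ResolutionOfSingularities.Theorems.WeightedInvariantLocalWeightedDropWildMonicSCleanStep
import Summits.ResolutionOfSingularities.ResolutionOfSingularities.Theorems.WeightedInvariantLocalWeightedDropWildMonicWCleanPreserve
import Summits.ResolutionOfSingularities.ResolutionOfSingularities.Theorems.WeightedInvariantLocalWeightedDropWildMonicFlagSettingDict

/-!
# `WeightedInvariant.LocalWeightedDrop`, line `hasse-ridge-face-selection`, S3ρ sub-stub S3ρD `stub_wildMonicSurfaceDescent`:
# THE SECONDARY CLEANING STEP EXISTS AND IMPROVES — Perlega §5.2.2 (Definition, Lemmas 5.2.6–5.2.8) assembled for monic tuples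

Crux item stmt-ResolutionOfSingularities-8899 `LocalWeightedDrop` (route `ResolutionOfSingularities/WeightedInvariant`), engine of
the door `HypersurfaceCentreConstruction` stmt-ResolutionOfSingularities-19897.  [OURS · L1 W4.3, chain w43, res-L1-w43-stub-7 (second
seat on S3ρ under res-type-083); item (C4d) of `L/res-L1-w43-stub-7/S3RHOD-ROADMAP.md`.  MODEL: S. Perlega, thesis Wien 2017 /
arXiv:2011.14443, Ch. 5 §2.2: the secondary `ord`-cleaning step at the least unclean index `b` (Definition), Lemma 5.2.6 (it preserves
`w`-cleanness for every weight `w` on `(x,y)`), Lemma 5.2.7 (it preserves the setting when `f` is `ord`-clean), Lemma 5.2.8 (either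
`s̃ > s`, or `s̃ = s` and `(i)–(iii)_{b′}` hold for all `b′ ≤ b`).  Nothing here is a statement of H. Hironaka's manuscript
[claim: Hironaka2017, status: under-review]; OUR objects.]

* (the setting `(δ, r)` as a function of `m_{(1,1)}, m_{(1,0)}, m_{(0,1)}` is res-L1-w43-stub-3's `…WildMonicFlagSettingDict`,
  p513565: `excExp_eq_of_wMin_eq`, `dRes_eq_of_wMin_eq`);
* `exists_sClean_step_data` — at a position that is NOT secondary clean (finite `s`), the data of the step: the least unclean index `b`,
  the on-line least term `c·x^{q·m}` of the row `bq` of the slot `d − q` (`q ∣` its exponent by `¬(iii)_b`), and `λ` with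
  `C(d,q)·λ^q = −c` (perfect field);
* `sClean_step` — THE STEP `shift d A (λ·x^m)`: it preserves `w`-cleanness and `m_w` for every weight (Lemma 5.1.7 via (a)), hence —
  at a position clean for `(1,1)`, and for `(1,0)` / `(0,1)` along the exceptional letters — the setting `(δ, r)`; `s` does not drop
  (Lemma 5.2.2 (1)); and if `s` stays, `SCleanAt` holds afterwards at every index `≤ b` (Lemma 5.2.8).
-/

set_option linter.dupNamespace false -- mandated namespace of this single-conjunct summit

noncomputable section

namespace Summit.ResolutionOfSingularities.ResolutionOfSingularities.Theorems

namespace WildMonic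

open MvPowerSeries MonicDescent

variable {k : Type} [Field k] {d : ℕ}

/-! ## The data of the secondary cleaning step -/

section Data

variable (p : ℕ) [Fact p.Prime] [CharP k p] [PerfectRing k p] (E : Finset (Fin 2)) (A : Fin d → MvPowerSeries (Fin 2) k)

/-- THE DATA OF THE SECONDARY CLEANING STEP at a position that is NOT secondary clean (finite `s`): the least unclean index `b`, the
on-line least term `c·x^{q·m}` (`m = (a′, b)`) of the row `b·q` of the slot `d − q`, the failure of `(i)_b`, and `λ ≠ 0` with
`C(d,q)·λ^q = −c` (Perlega §5.2.2 Definition: `g_b = −C(c,q)^{-1}·G`, `in(f_{c−q,bq}) = in(f_c)·G^q`). -/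
theorem exists_sClean_step_data {s : ℕ} (hs : sFlag E (newtonSet A) = s) (hns : ¬ IsSClean p E A)
    (iq : Fin d) (hiq : (iq : ℕ) = d - qOf p d) :
    ∃ (b : ℕ) (m : Fin 2 →₀ ℕ) (lam : k),
      d.factorial * b < dRes E (newtonSet A) + excExp E (newtonSet A) 1 ∧ ¬ SCleanAt p E A b ∧ (∀ b' < b, SCleanAt p E A b') ∧
      m 1 = b ∧ coeff (qOf p d • m) (A iq) ≠ 0 ∧
      OnSLine (dRes E (newtonSet A)) (s : ℕ∞) (redPt A E iq (qOf p d • m)) ∧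
      (¬ ∃ (i : Fin d) (e : Fin 2 →₀ ℕ), d - qOf p d < (i : ℕ) ∧ coeff e (A i) ≠ 0 ∧ e 1 ≤ (d - (i : ℕ)) * b ∧
        OnSLine (dRes E (newtonSet A)) (s : ℕ∞) (redPt A E i e)) ∧
      lam ≠ 0 ∧ ((d.choose (iq : ℕ) : ℕ) : k) * lam ^ qOf p d = - coeff (qOf p d • m) (A iq) := by
  classical
  have hd : 0 < d := Fin.pos iq
  have hq : qOf p d ≤ d := Nat.le_of_dvd hd (qOf_dvd p d)
  have hqpos := qOf_pos p d
  obtain ⟨b, hb, hnot, hbefore⟩ := exists_min_not_sCleanAt p E A hns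
  have hnot' := hnot
  unfold SCleanAt at hnot'
  rw [hs] at hnot'
  simp only [not_or] at hnot'
  obtain ⟨hC1, hC2, hC3⟩ := hnot'
  -- `¬(ii)_b`: a monomial `e₀` of the row `bq` of the slot `d − q` that is not strictly above, i.e. on the line
  simp only [not_forall] at hC2
  obtain ⟨i, e₀, hi, he₀, he₀1, hnabove⟩ := hC2
  have hii : i = iq := Fin.ext (by rw [hi, hiq])
  subst hii
  have hge₀ := theta_le_val E A rfl rfl hs.ge i he₀
  have hval₀ : slotWeight d i * Finsupp.weight ![(dRes E (newtonSet A)).factorial, s] e₀ =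
      s * dRes E (newtonSet A) + Finsupp.weight ![(dRes E (newtonSet A)).factorial, s] (excExp E (newtonSet A)) := by
    by_contra hne
    exact hnabove ((aboveSLine_iff_val E A rfl s i he₀).2 fun _ => lt_of_le_of_ne hge₀ (Ne.symm hne))
  have hrowlt : slotWeight d i * e₀ 1 < dRes E (newtonSet A) + excExp E (newtonSet A) 1 := by
    rw [he₀1, mul_comm b, ← mul_assoc, show slotWeight d i * qOf p d = d.factorial by
      have h := slotWeight_mul_sub i; rwa [show d - (i : ℕ) = qOf p d by omega] at h]
    exact hb
  -- the least exponent `a` of the row `bq`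
  have hexa : ∃ a : ℕ, coeff (Finsupp.single 0 a + Finsupp.single 1 (b * qOf p d)) (A i) ≠ 0 := by
    refine ⟨e₀ 0, ?_⟩
    have hE : Finsupp.single 0 (e₀ 0) + Finsupp.single 1 (b * qOf p d) = e₀ := by
      rw [← he₀1]; ext l; fin_cases l <;> simp
    rw [hE]; exact he₀
  obtain ⟨a, hrowmin⟩ : ∃ a : ℕ, RowMin (A i) (b * qOf p d) a :=
    ⟨Nat.find hexa, Nat.find_spec hexa, fun a' ha' => by_contra fun hne => Nat.find_min hexa ha' hne⟩
  -- `¬(iii)_b`: `q` divides it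
  have hdvd : qOf p d ∣ a := by
    by_contra hnd
    exact hC3 ⟨i, a, hi, hrowmin, hnd⟩
  obtain ⟨a', rfl⟩ := hdvd
  refine ⟨b, Finsupp.single 0 a' + Finsupp.single 1 b, ?_⟩
  have hqm : qOf p d • (Finsupp.single 0 a' + Finsupp.single 1 b : Fin 2 →₀ ℕ) =
      Finsupp.single 0 (qOf p d * a') + Finsupp.single 1 (b * qOf p d) := by
    ext l
    fin_cases l <;> simp [mul_comm]
  have hstar : coeff (qOf p d • (Finsupp.single 0 a' + Finsupp.single 1 b : Fin 2 →₀ ℕ)) (A i) ≠ 0 := by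
    rw [hqm]; exact hrowmin.1
  -- the least term is on the line: its scaled line weight is `≤` that of `e₀`, which is `Θ`
  have hle_a : qOf p d * a' ≤ e₀ 0 := by
    by_contra hlt
    rw [not_le] at hlt
    have h0 := hrowmin.2 (e₀ 0) hlt
    have hE : Finsupp.single 0 (e₀ 0) + Finsupp.single 1 (b * qOf p d) = e₀ := by
      rw [← he₀1]; ext l; fin_cases l <;> simp
    rw [hE] at h0
    exact he₀ h0
  have hval_a : slotWeight d i * Finsupp.weight ![(dRes E (newtonSet A)).factorial, s]
      (qOf p d • (Finsupp.single 0 a' + Finsupp.single 1 b : Fin 2 →₀ ℕ)) =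
      s * dRes E (newtonSet A) + Finsupp.weight ![(dRes E (newtonSet A)).factorial, s] (excExp E (newtonSet A)) := by
    apply le_antisymm _ (theta_le_val E A rfl rfl hs.ge i hstar)
    rw [← hval₀, hqm]
    apply Nat.mul_le_mul_left
    rw [Literature.AlgebraicGeometry.Resolution.WeightedShear.weight_fin_two,
      Literature.AlgebraicGeometry.Resolution.WeightedShear.weight_fin_two]
    simp only [Finsupp.add_apply, Finsupp.single_apply]
    simp only [Fin.zero_eq_one_iff, if_true, Fin.one_eq_zero_iff]
    simp only [OfNat.ofNat_ne_one, if_false, add_zero, zero_add, he₀1]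
    exact Nat.add_le_add_right (Nat.mul_le_mul_left _ hle_a) _
  have hon : OnSLine (dRes E (newtonSet A)) (s : ℕ∞) (redPt A E i (qOf p d • (Finsupp.single 0 a' + Finsupp.single 1 b))) := by
    refine (onSLine_iff_val E A rfl s i hstar).2 ⟨?_, hval_a⟩
    have : (qOf p d • (Finsupp.single 0 a' + Finsupp.single 1 b : Fin 2 →₀ ℕ)) 1 = e₀ 1 := by rw [hqm, he₀1]; simp
    rw [this]; exact hrowlt
  -- `λ`: a `q`-th root of `−c / C(d,q)` in the perfect field
  have hC : ((d.choose (i : ℕ) : ℕ) : k) ≠ 0 := by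
    rw [hi, Nat.choose_symm hq]; exact natCast_choose_qOf_ne_zero p hd
  set c := coeff (qOf p d • (Finsupp.single 0 a' + Finsupp.single 1 b : Fin 2 →₀ ℕ)) (A i) with hcdef
  set lam := (iterateFrobeniusEquiv k p (d.factorization p)).symm (-c * ((d.choose (i : ℕ) : ℕ) : k)⁻¹) with hlamdef
  have hlamq : lam ^ qOf p d = -c * ((d.choose (i : ℕ) : ℕ) : k)⁻¹ := by
    rw [show qOf p d = p ^ d.factorization p from rfl, ← iterateFrobenius_def, hlamdef]
    exact (iterateFrobeniusEquiv k p (d.factorization p)).apply_symm_apply _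
  refine ⟨lam, hb, hnot, hbefore, by simp, hstar, hon, hC1, ?_, ?_⟩
  · intro h0
    have : lam ^ qOf p d = 0 := by rw [h0]; exact zero_pow hqpos.ne'
    rw [hlamq] at this
    exact (mul_ne_zero (neg_ne_zero.2 hstar) (inv_ne_zero hC)) this
  · rw [hlamq]; field_simp

end Data

/-! ## The step -/

section TheStep

variable (p : ℕ) [Fact p.Prime] [CharP k p] [PerfectRing k p] (E : Finset (Fin 2)) (A : Fin d → MvPowerSeries (Fin 2) k)

/-- THE SECONDARY CLEANING STEP (Perlega §5.2.2 with Lemmas 5.2.6–5.2.8) for monic tuples.  At a position with finite `s = sFlag` that is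
`(1,1)`-clean, `(1,0)`-clean if `0 ∈ E` and `(0,1)`-clean if `1 ∈ E`, and NOT secondary clean, the monomial re-centring
`B = shift d A (λ·x^m)` of the Definition satisfies: every `w`-cleanness of `A` passes to `B` with the same `m_w` (Lemma 5.2.6), the
setting `(δ, r)` is preserved (Lemma 5.2.7), `s ≤ sFlag(B)` (Lemma 5.2.2 (1)), and IF `sFlag(B) = s` then `SCleanAt p E B b′` for all
`b′ ≤ b`, `b` the least unclean index of `A` (Lemma 5.2.8). -/
theorem sClean_step {s : ℕ} (hs : sFlag E (newtonSet A) = s) (hns : ¬ IsSClean p E A)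
    (iq : Fin d) (hiq : (iq : ℕ) = d - qOf p d)
    (h11 : IsWClean p ![1, 1] A) (h10 : (0 : Fin 2) ∈ E → IsWClean p ![1, 0] A) (h01 : (1 : Fin 2) ∈ E → IsWClean p ![0, 1] A) :
    ∃ (m : Fin 2 →₀ ℕ) (lam : k) (b : ℕ), lam ≠ 0 ∧
      d.factorial * b < dRes E (newtonSet A) + excExp E (newtonSet A) 1 ∧ ¬ SCleanAt p E A b ∧ (∀ b' < b, SCleanAt p E A b') ∧
      (∀ w : Fin 2 → ℕ, wMin w A ≤ (d.factorial : ℕ∞) * (monomial m lam).weightedOrder w) ∧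
      (∀ w : Fin 2 → ℕ, IsWClean p w A →
        IsWClean p w (shift d A (monomial m lam)) ∧ wMin w (shift d A (monomial m lam)) = wMin w A) ∧
      excExp E (newtonSet (shift d A (monomial m lam))) = excExp E (newtonSet A) ∧
      dRes E (newtonSet (shift d A (monomial m lam))) = dRes E (newtonSet A) ∧
      (s : ℕ∞) ≤ sFlag E (newtonSet (shift d A (monomial m lam))) ∧
      (sFlag E (newtonSet (shift d A (monomial m lam))) = s → ∀ b' ≤ b, SCleanAt p E (shift d A (monomial m lam)) b') := by
  obtain ⟨b, m, lam, hb, hnot, hbefore, hm1, hstar, hon, hC1, hlam0, hlam⟩ := exists_sClean_step_data p E A hs hns iq hiq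
  refine ⟨m, lam, b, hlam0, hb, hnot, hbefore, ?_⟩
  -- `d!·ord_w(λx^m) = d!·w(m) ≥ slotWOrd w A (d−q) ≥ m_w(A)` for every weight: condition (a) of Lemma 5.1.7
  have hordg : ∀ w : Fin 2 → ℕ, (d.factorial : ℕ∞) * (monomial m lam).weightedOrder w = ((d.factorial * Finsupp.weight w m : ℕ) : ℕ∞) := by
    intro w; rw [weightedOrder_monomial_of_ne_zero w hlam0]; push_cast; rfl
  have hcondA : ∀ w : Fin 2 → ℕ, slotWOrd w A iq ≤ (d.factorial : ℕ∞) * (monomial m lam).weightedOrder w := by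
    intro w
    rw [hordg, ← slotWeight_mul_weight_qOf_smul w m p iq hiq]
    exact (le_slotWOrd_iff A w iq).1 le_rfl _ hstar
  have hGm : ∀ w : Fin 2 → ℕ, wMin w A ≤ (d.factorial : ℕ∞) * (monomial m lam).weightedOrder w :=
    fun w => (wMin_le_slotWOrd w A iq).trans (hcondA w)
  have hmfin : ∀ w : Fin 2 → ℕ, wMin w A ≠ ⊤ := by
    intro w
    refine ne_top_of_le_ne_top ?_ ((wMin_le_slotWOrd w A iq).trans ((le_slotWOrd_iff A w iq).1 le_rfl _ hstar))
    exact ENat.coe_ne_top _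
  have hpres : ∀ w : Fin 2 → ℕ, IsWClean p w A →
      IsWClean p w (shift d A (monomial m lam)) ∧ wMin w (shift d A (monomial m lam)) = wMin w A :=
    fun w hw => ⟨isWClean_shift_of_isWClean p w A _ hw (hmfin w) hiq (Or.inl (hcondA w)),
      wMin_shift_eq_of_isWClean p w A _ hw (hmfin w) (hGm w)⟩
  refine ⟨hGm, hpres, ?_⟩
  -- the setting is preserved (stub-3's dictionary `(δ, r) ↔ (m_{(1,1)}, m_{(1,0)}, m_{(0,1)})`)
  have hr : excExp E (newtonSet (shift d A (monomial m lam))) = excExp E (newtonSet A) :=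
    excExp_eq_of_wMin_eq E (fun h => (hpres _ (h10 h)).2) (fun h => (hpres _ (h01 h)).2)
  have hδ : dRes E (newtonSet (shift d A (monomial m lam))) = dRes E (newtonSet A) :=
    dRes_eq_of_wMin_eq E (fun h => (hpres _ (h10 h)).2) (fun h => (hpres _ (h01 h)).2) (hpres _ h11).2
  refine ⟨hr, hδ, ?_, ?_⟩
  · -- Lemma 5.2.2 (1): `g` is ON the `s`-line
    refine natCast_le_sFlag_shift E E A (monomial m lam) hs.ge hδ hr (le_of_eq ?_)
    rw [hordg, factorial_mul_weight_eq_theta p E A rfl hiq hstar hon]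
  · -- Lemma 5.2.8
    intro hsB b' hb'
    rcases hb'.lt_or_eq with hlt | heq
    · exact sCleanAt_shift_of_lt p E A rfl rfl hs hiq hb hm1 hstar hon hlam hδ hr hsB hlt (hbefore b' hlt)
    · rw [heq]
      exact sCleanAt_shift_self p E A rfl rfl hs hiq hb hm1 hstar hon hlam hδ hr hsB hC1

end TheStep

end WildMonic

end Summit.ResolutionOfSingularities.ResolutionOfSingularities.Theorems

end
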